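import Mathlib
import Summits.KontsevichZagierPeriods.Zeta5Search.DenomLaw.ProfileA5Assembly
import Summits.KontsevichZagierPeriods.Zeta5Search.DenomLaw.ProfileA5PathS
import Summits.KontsevichZagierPeriods.Zeta5Search.DenomLaw.ProfileA7Assembly
import HarnessLib

/-!
# ζ(5) search — THE a = 5 ASSEMBLY AT DEPTH d < 2p, UNCONDITIONAL: `PathAccountingFirstPeriod` for EVERY sorted parameter vector with exactly five long parameters, every direction (DENOM-LAW D1, prover-d1 gen 25)

Cell `pub-zeta5` (HONEST FRAMING: systematic search; no irrationality claim unless certified), TRACK «DENOM-LAW» D1 prover seat (denom-prover-d1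
gen 25, `HOME/denom-law/prover-d1/ATTEMPT-25.md` §1).  The node `DenomLaw.PathAccountingFirstPeriod` (`@[conjecture]`, ∀ b) restricted to the a = 5
STRATUM of the first period at depth `⌊d/p⌋ ≤ 1` — every sorted `b` in the Brown–Zudilin polytope with `b₆ < p ≤ b₅` and `d < 2p` (4,186 / 83,707
first-period instances at p = 7 / 11 in the stratum; 3,116 / 60,038 at `d < 2p`) — is a THEOREM with NO further hypothesis: **`pathAccounting_a5_all`**
(every direction `j`) and **`pathAccountingFirstPeriod_a5_all`** (the node's binders VERBATIM plus ONLY `b₆ < p`, `p ≤ b₅`, `d < 2p`).  PROOF = one case split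
on gen 24's order disjunction `b₀ < p + b₁ + b₆ ∨ p + b₂ + b₅ ≤ b₀ ∨ p + b₃ + b₄ ≤ b₀`: ON it, gen 24's `ProfileA5Assembly.pathAccounting_a5_offU16` (61 leaves:
47 profile theorems, the `N_p = 0` lemma, 13 vacuous leaves); OFF it — the A5U16 order region `p + b₁ + b₆ ≤ b₀ < min(p + b₂ + b₅, p + b₃ + b₄)` (488 / 8,044
instances at p = 7 / 11 at `d < 2p`) — two more order tests `(3,5)` and `(4,5)` select one of the three profiles generated by (1,6),(3,5) | (1,6),(4,5) | (1,6)
and `ProfileA5PathS.pathAccounting_profileA5P1635 / A5P1645 / A5P16` close them: THEOREM LB♯ `cover_LBP_j` at `(v, r) = (−6, −3)` off `p ≤ d` and, at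
`p ≤ d`, the ONE-KEY COLLINEARITY RUNG `CollinearOneKeyKit.cover_O1_j` (`c = −8` = the node) — the obstruction named by gen 24 (a single-pole class of type
`[0,−6,0]` beside the live pair `(1,−6,−1) ~ (−1,−6,1)` kills `checkJ`) dissolves because a centre-free palindromic type is not live, so the live deep keys
are ONE key and `collinearityCriterion_holds` (through the origin; no parity, no moment range) applies.  p-UNIFORM: no hypothesis names a prime or a
residue.  With gen 23's `pathAccountingFirstPeriod_a7_all` and gen 24's `pathAccountingFirstPeriod_a6_all` the node is now a theorem on the strata a = 7
(every depth), a = 6 and a = 5 (`⌊d/p⌋ ≤ 1`) — joined here as **`pathAccountingFirstPeriod_ge5_all`** (binders VERBATIM plus ONLY `p ≤ b₅`, `d < 2p`: every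
sorted `b` with AT LEAST FIVE long parameters at depth `⌊d/p⌋ ≤ 1`).  OPEN beyond this file: the depth `⌊d/p⌋ ≥ 2` of the strata a ≤ 6, the strata a ≤ 4.  MODEL/structure-side
valuation bookkeeping of the cell's own rationals (contiguity Casoratians of Brown–Zudilin dual coefficients); the ∀-b node stays `@[conjecture]`; nothing
about ζ(5); no γ; records in print UNMOVED.
-/

open Finset

namespace Summit.KontsevichZagierPeriods.Zeta5Search.FullProfile

open Summit.KontsevichZagierPeriods.Zeta5Search.ClusterValuation
open Summit.KontsevichZagierPeriods.Zeta5Search.CasoratianValuation (InPolytope shift casoratian pairFloors refund)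
open Summit.KontsevichZagierPeriods.Zeta5Search.WedgeDictionary (dOf)
open Summit.KontsevichZagierPeriods.Zeta5Search.DenomLaw (cStar FirstPeriod Sorted7)

/-- **THE a = 5 ASSEMBLY AT DEPTH `d < 2p`, UNCONDITIONAL: `PathAccountingFirstPeriod`'s conclusion for EVERY sorted `b` with exactly five long
parameters (`b₆ < p ≤ b₅`) and `d < 2p`, every direction `j`** — gen 24's `pathAccounting_a5_offU16` on its order disjunction, and on the complementary
A5U16 region the three profile theorems of `ProfileA5PathS` (THEOREM LB♯ + the one-key collinearity rung), selected by the order tests `(3,5)`, `(4,5)`. -/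
theorem pathAccounting_a5_all (b : ℕ → ℤ) (j p : ℕ) (hb : InPolytope b) (hs : Sorted7 b) (hbj : InPolytope (shift b j))
    (hj1 : 1 ≤ j) (hj7 : j ≤ 7) (hprime : p.Prime) (hp5 : 5 ≤ p) (hwin : (b 0 + 2 : ℤ) < (p : ℤ) ^ 2) (hfp : FirstPeriod b p)
    (hA : b 6 < (p : ℤ)) (hA5 : (p : ℤ) ≤ b 5) (hd2 : dOf b < 2 * (p : ℤ)) (hcas : casoratian b j ≠ 0) :
    dOf b / (p : ℤ) - pairFloors b p - min (if 2 ≤ dOf b / (p : ℤ) then (1 : ℤ) else 0) (5 - (cStar b p : ℤ))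
      ≤ padicValRat p (casoratian b j) := by
  by_cases hoff : b 0 < (p : ℤ) + b 1 + b 6 ∨ (p : ℤ) + b 2 + b 5 ≤ b 0 ∨ (p : ℤ) + b 3 + b 4 ≤ b 0
  · exact pathAccounting_a5_offU16 b j p hb hs hbj hj1 hj7 hprime hp5 hwin hfp hA hA5 hoff hd2 hcas
  · have hL16 : (p : ℤ) + b 1 + b 6 ≤ b 0 := by
      by_contra h
      exact hoff (Or.inl (lt_of_not_ge h))
    have hS25 : b 0 < (p : ℤ) + b 2 + b 5 := by
      by_contra h
      exact hoff (Or.inr (Or.inl (le_of_not_gt h)))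
    have hS34 : b 0 < (p : ℤ) + b 3 + b 4 := by
      by_contra h
      exact hoff (Or.inr (Or.inr (le_of_not_gt h)))
    by_cases hL35 : (p : ℤ) + b 3 + b 5 ≤ b 0
    · exact pathAccounting_profileA5P1635 b j p hb hs hbj hj1 hj7 hprime hp5 hwin hfp hA hA5 hL16 hL35 hS25 hS34 hd2 hcas
    · have hS35 : b 0 < (p : ℤ) + b 3 + b 5 := lt_of_not_ge hL35
      by_cases hL45 : (p : ℤ) + b 4 + b 5 ≤ b 0
      · exact pathAccounting_profileA5P1645 b j p hb hs hbj hj1 hj7 hprime hp5 hwin hfp hA hA5 hL16 hL45 hS35 hd2 hcas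
      · exact pathAccounting_profileA5P16 b j p hb hs hbj hj1 hj7 hprime hp5 hwin hfp hA hA5 hL16 (lt_of_not_ge hL45) hd2 hcas

/-- **THE NODE ON THE WHOLE a = 5 STRATUM AT DEPTH `⌊d/p⌋ ≤ 1`: `PathAccountingFirstPeriod` with its binders VERBATIM plus ONLY `b₆ < p`, `p ≤ b₅`
and `d < 2p`.** -/
theorem pathAccountingFirstPeriod_a5_all :
    ∀ (b : ℕ → ℤ) (p : ℕ), InPolytope b → Sorted7 b → InPolytope (shift b 7) →
      p.Prime → 5 ≤ p → (b 0 + 2 : ℤ) < (p : ℤ) ^ 2 → FirstPeriod b p →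
      b 6 < (p : ℤ) → (p : ℤ) ≤ b 5 → dOf b < 2 * (p : ℤ) → casoratian b 7 ≠ 0 →
        dOf b / (p : ℤ) - pairFloors b p - min (if 2 ≤ dOf b / (p : ℤ) then (1 : ℤ) else 0) (5 - (cStar b p : ℤ))
          ≤ padicValRat p (casoratian b 7) :=
  fun b p hb hs hb7 hprime hp5 hwin hfp hA hA5 hd2 hcas =>
    pathAccounting_a5_all b 7 p hb hs hb7 (by norm_num) (by norm_num) hprime hp5 hwin hfp hA hA5 hd2 hcas

/-- **AT LEAST FIVE LONG PARAMETERS, depth `⌊d/p⌋ ≤ 1`, in one statement**: `PathAccountingFirstPeriod`'s conclusion for every sorted `b` with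
`p ≤ b₅` and `d < 2p`, every direction `j` — two case splits on `p ≤ b₇` / `p ≤ b₆` between gen 23's `pathAccounting_a7_all` (a = 7, any depth),
gen 24's `pathAccounting_a6_all` (a = 6) and `pathAccounting_a5_all` (a = 5). -/
theorem pathAccounting_ge5_all (b : ℕ → ℤ) (j p : ℕ) (hb : InPolytope b) (hs : Sorted7 b) (hbj : InPolytope (shift b j))
    (hj1 : 1 ≤ j) (hj7 : j ≤ 7) (hprime : p.Prime) (hp5 : 5 ≤ p) (hwin : (b 0 + 2 : ℤ) < (p : ℤ) ^ 2) (hfp : FirstPeriod b p)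
    (hA5 : (p : ℤ) ≤ b 5) (hd2 : dOf b < 2 * (p : ℤ)) (hcas : casoratian b j ≠ 0) :
    dOf b / (p : ℤ) - pairFloors b p - min (if 2 ≤ dOf b / (p : ℤ) then (1 : ℤ) else 0) (5 - (cStar b p : ℤ))
      ≤ padicValRat p (casoratian b j) := by
  by_cases h7 : (p : ℤ) ≤ b 7
  · exact pathAccounting_a7_all b j p hb hs hbj hj1 hj7 hprime hp5 hwin hfp h7 hcas
  · by_cases h6 : (p : ℤ) ≤ b 6
    · exact pathAccounting_a6_all b j p hb hs hbj hj1 hj7 hprime hp5 hwin hfp (lt_of_not_ge h7) h6 hd2 hcas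
    · exact pathAccounting_a5_all b j p hb hs hbj hj1 hj7 hprime hp5 hwin hfp (lt_of_not_ge h6) hA5 hd2 hcas

/-- **THE NODE FOR EVERY SORTED `b` WITH AT LEAST FIVE LONG PARAMETERS AT DEPTH `⌊d/p⌋ ≤ 1`: `PathAccountingFirstPeriod` with its binders VERBATIM
plus ONLY `p ≤ b₅` and `d < 2p`** (the strata a = 7, 6, 5 of gens 23, 24, 25 joined). -/
theorem pathAccountingFirstPeriod_ge5_all :
    ∀ (b : ℕ → ℤ) (p : ℕ), InPolytope b → Sorted7 b → InPolytope (shift b 7) →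
      p.Prime → 5 ≤ p → (b 0 + 2 : ℤ) < (p : ℤ) ^ 2 → FirstPeriod b p →
      (p : ℤ) ≤ b 5 → dOf b < 2 * (p : ℤ) → casoratian b 7 ≠ 0 →
        dOf b / (p : ℤ) - pairFloors b p - min (if 2 ≤ dOf b / (p : ℤ) then (1 : ℤ) else 0) (5 - (cStar b p : ℤ))
          ≤ padicValRat p (casoratian b 7) :=
  fun b p hb hs hb7 hprime hp5 hwin hfp hA5 hd2 hcas =>
    pathAccounting_ge5_all b 7 p hb hs hb7 (by norm_num) (by norm_num) hprime hp5 hwin hfp hA5 hd2 hcas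

end Summit.KontsevichZagierPeriods.Zeta5Search.FullProfile
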